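import Literature.Geometry.Lorentzian.ConnectionNaturality
import Literature.Geometry.Lorentzian.CurvatureRegularity
import HarnessLib

/-!
# Naturality of the Riemann, Ricci and scalar curvature under local diffeomorphisms

Support file (all results proved) for Bartnik's existence theorem for the ADM energy
(`Literature.Geometry.Lorentzian.AFEnd.HasADMEnergy_of_isAsymptoticallyFlat`): the scalar
curvature of the data `(X, h)` read in the chart of the end is the scalar curvature of the
pulled-back metric on the model `{R < ‖x‖} ⊆ ℝ³`, where it can be computed in coordinates.

Continuing `ConnectionNaturality.lean`: `Φ : N → M` is a smooth equidimensional immersion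
(local diffeomorphism), `g` a smooth metric on `M`, `Φ^* g` its pullback. We prove

* `curvatureAux_comap_mpullback` — the bare curvature operation is natural on pulled-back fields;
* `riemann_comap_apply` — `R^{Φ^*g}_u (X₀, Y₀) Z₀ = (dΦ_u)⁻¹ R^g_{Φ u}(dΦ X₀, dΦ Y₀) dΦ Z₀`
  (O'Neill 1983, Ch. 3, Prop. 3.59: isometries preserve curvature; here for the canonical local
  isometry `Φ : (N, Φ^*g) → (M, g)`), via `curvature_apply` on both sides with the extensions of
  `dΦ X₀, dΦ Y₀, dΦ Z₀` and their pullbacks;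
* `ricci_comap_apply` — `Ric^{Φ^*g}_u (Y₀, Z₀) = Ric^g_{Φ u}(dΦ Y₀, dΦ Z₀)` (trace of a
  conjugate endomorphism);
* `scalarCurvature_comap` — `S^{Φ^*g}(u) = S^g(Φ u)` (metric traces in the bases `β` and `dΦ β`).

Regularity: the statements are proved for a `C^n` metric, `n ≥ 2`, and a `C^{n+1}` map `Φ`
(suffix `_cn`: `curvatureAux_comap_mpullback_cn`, `riemann_comap_apply_cn`, `ricci_comap_apply_cn`,
`scalarCurvature_comap_cn`; local `C¹`-regularity of the Levi-Civita connection and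
`curvature_apply` need exactly `C²`); the `C^∞` statements (original names, unchanged signatures)
are their specialisations `n = ∞`. The finite-regularity case serves `C²` conformal
compactifications `ḡ = ρ² g⁺` pulled back along the interior embedding (Li–Qing–Shi 2017,
Def. 2.1, Lemma 1.6; proof of Thm. 1.8, Step 1).

## References

* B. O'Neill, *Semi-Riemannian geometry* (1983), Ch. 3, Prop. 3.59, Cor. 3.60–3.61, pp. 90–91.
* J. M. Lee, *Introduction to Riemannian Manifolds* (2018), Prop. 7.? (naturality of curvature,
  "local isometries preserve curvature", Thm. 7.10 ff.).
-/

noncomputable section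

open Bundle Set Function Filter FiberBundle VectorField ContinuousLinearMap
open scoped Manifold ContDiff Topology

namespace Literature.Geometry.Lorentzian

namespace PseudoRiemannianMetric

/-! ### The inverse differential -/

section Helpers

variable {E : Type*} [NormedAddCommGroup E] [NormedSpace ℝ E] {H : Type*} [TopologicalSpace H]
  {I : ModelWithCorners ℝ E H} {M : Type*} [TopologicalSpace M] [ChartedSpace H M]
  [IsManifold I ∞ M]
  {E' : Type*} [NormedAddCommGroup E'] [NormedSpace ℝ E'] {H' : Type*} [TopologicalSpace H']
  {I' : ModelWithCorners ℝ E' H'} {N : Type*} [TopologicalSpace N] [ChartedSpace H' N]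
  [IsManifold I' ∞ N]
  [FiniteDimensional ℝ E] [FiniteDimensional ℝ E'] [CompleteSpace E] [CompleteSpace E']
  {Φ : N → M} (hdim : Module.finrank ℝ E' = Module.finrank ℝ E)

omit [IsManifold I ∞ M] [IsManifold I' ∞ N] [CompleteSpace E] [CompleteSpace E'] in
include hdim in
/-- The inverse differential is the inverse linear equivalence `(dΦ_u)⁻¹`. [folklore] -/
theorem inverse_mfderiv_apply {u : N} (hu : Function.Injective (mfderiv I' I Φ u))
    (w : TangentSpace I (Φ u)) :
    (mfderiv I' I Φ u).inverse w =
      (mfderivEquivOfInjective (I := I) (I' := I') Φ u hu hdim).symm w := by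
  have hinv := isInvertible_mfderiv_of_injective (Φ := Φ) hdim hu
  rw [hinv.inverse_apply_eq]
  exact (mfderiv_mfderivEquivOfInjective_symm (I := I) (I' := I') Φ u hu hdim w).symm

end Helpers

/-! ### Naturality of the curvature tensors: `C^n` metric, `n ≥ 2` -/

section Cn

variable {E : Type*} [NormedAddCommGroup E] [NormedSpace ℝ E] {H : Type*} [TopologicalSpace H]
  {I : ModelWithCorners ℝ E H} {M : Type*} [TopologicalSpace M] [ChartedSpace H M]
  [IsManifold I ∞ M]
  {E' : Type*} [NormedAddCommGroup E'] [NormedSpace ℝ E'] {H' : Type*} [TopologicalSpace H']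
  {I' : ModelWithCorners ℝ E' H'} {N : Type*} [TopologicalSpace N] [ChartedSpace H' N]
  [IsManifold I' ∞ N]
  [FiniteDimensional ℝ E] [FiniteDimensional ℝ E'] [CompleteSpace E] [CompleteSpace E']
  {n : ℕ∞ω} [Fact (1 ≤ n)]
  (g : PseudoRiemannianMetric I n E (TangentSpace I : M → Type _))
  {Φ : N → M} (hpb : contMDiff_pullbackBilin I M I' N n) (hΦ : ContMDiff I' I (n + 1) Φ)
  (hΦ' : ∀ u, Function.Injective (mfderiv I' I Φ u))
  (hdim : Module.finrank ℝ E' = Module.finrank ℝ E)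

include hΦ' in
/-- **Naturality of the bare curvature operation** for a `C^n` metric, `n ≥ 2`: for vector fields
`X, Y` of class `C¹` and `Z` of class `C²` on an open set `O ∋ Φ u` of `M`,
`(∇∇Z - ∇∇Z - ∇_{[·,·]}Z)^{Φ^*g}(Φ^*X, Φ^*Y, Φ^*Z)(u) = (dΦ_u)⁻¹ (same for g)(X, Y, Z)(Φ u)`.
O'Neill 1983, Ch. 3, proof of Prop. 3.59. [cite: ONeill1983, Ch. 3, Prop. 3.59] -/
theorem curvatureAux_comap_mpullback_cn [g.HasLeviCivita] [(g.comap hpb Φ hΦ hΦ' hdim).HasLeviCivita]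
    (hn : 2 ≤ n) {u : N} {O : Set M} (hO : IsOpen O) (huO : Φ u ∈ O)
    {X Y Z : Π x : M, TangentSpace I x}
    (hX : CMDiff[O] 1 (T% X)) (hY : CMDiff[O] 1 (T% Y)) (hZ : CMDiff[O] 2 (T% Z)) :
    CovariantDerivative.curvatureAux (g.comap hpb Φ hΦ hΦ' hdim).leviCivita (mpullback I' I Φ X)
        (mpullback I' I Φ Y) (mpullback I' I Φ Z) u =
      (mfderiv I' I Φ u).inverse
        (CovariantDerivative.curvatureAux g.leviCivita X Y Z (Φ u)) := by
  set gN := g.comap hpb Φ hΦ hΦ' hdim with hgN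
  have h1n : (1 : ℕ∞ω) ≤ n := Fact.out
  have h2 : (2 : ℕ∞ω) ≤ n + 1 := by
    calc (2 : ℕ∞ω) = 1 + 1 := by norm_num
      _ ≤ n + 1 := add_le_add h1n le_rfl
  have hΦs : ContMDiff I' I n Φ := hΦ.of_le le_self_add
  have hinv : ∀ u', (mfderiv I' I Φ u').IsInvertible := fun u' ↦
    isInvertible_mfderiv_of_injective hdim (hΦ' u')
  have hmin : minSmoothness ℝ 2 ≤ n + 1 := by rwa [minSmoothness_of_isRCLikeNormedField]
  haveI : IsManifold I' (minSmoothness ℝ 2) N := by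
    rw [minSmoothness_of_isRCLikeNormedField]; infer_instance
  haveI : IsManifold I (minSmoothness ℝ 2) M := by
    rw [minSmoothness_of_isRCLikeNormedField]; infer_instance
  have hregM : g.leviCivita.IsLocallyContMDiff 1 :=
    g.isLocallyContMDiff_leviCivita_holds 1 (by
      calc ((1 : ℕ∞) : ℕ∞ω) + 1 = 2 := by norm_num
        _ ≤ n := hn)
  -- differentiability on `O` and on its preimage
  have hXd : ∀ x ∈ O, MDiffAt (T% X) x := fun x hx ↦
    ((hX x hx).contMDiffAt (hO.mem_nhds hx)).mdifferentiableAt one_ne_zero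
  have hYd : ∀ x ∈ O, MDiffAt (T% Y) x := fun x hx ↦
    ((hY x hx).contMDiffAt (hO.mem_nhds hx)).mdifferentiableAt one_ne_zero
  have hZd : ∀ x ∈ O, MDiffAt (T% Z) x := fun x hx ↦
    ((hZ x hx).contMDiffAt (hO.mem_nhds hx)).mdifferentiableAt two_ne_zero
  have hpull : ∀ {A : Π x : M, TangentSpace I x} {u' : N}, MDiffAt (T% A) (Φ u') →
      MDiffAt (T% (mpullback I' I Φ A)) u' := fun {A u'} hA ↦
    hA.mpullback_vectorField (hΦ u') (hinv u') h2
  have hOpre : IsOpen (Φ ⁻¹' O) := hO.preimage hΦs.continuous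
  have huO' : u ∈ Φ ⁻¹' O := huO
  -- the iterated covariant derivatives along `W = X` or `W = Y`
  have key : ∀ {V W : Π x : M, TangentSpace I x}, CMDiff[O] 1 (T% V) → CMDiff[O] 1 (T% W) →
      gN.leviCivita (fun u' ↦ gN.leviCivita (mpullback I' I Φ Z) u' (mpullback I' I Φ W u')) u
          (mpullback I' I Φ V u) =
        (mfderiv I' I Φ u).inverse
          (g.leviCivita (fun x ↦ g.leviCivita Z x (W x)) (Φ u) (V (Φ u))) := by
    intro V W hV hW
    -- the field `∇^M_W Z` and its pullback
    set S : Π x : M, TangentSpace I x := fun x ↦ g.leviCivita Z x (W x) with hS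
    have hSd : MDiffAt (T% S) (Φ u) := g.leviCivita.mdifferentiableAt_cov_apply hregM hO huO hW hZ
    -- near `u`, `∇^N_{Φ^*W} Φ^*Z = Φ^* S`
    have hloc : (fun u' ↦ gN.leviCivita (mpullback I' I Φ Z) u' (mpullback I' I Φ W u')) =ᶠ[𝓝 u]
        mpullback I' I Φ S := by
      filter_upwards [hOpre.mem_nhds huO'] with u' hu'
      exact g.leviCivita_comap_mpullback_mpullback_cn hpb hΦ hΦ' hdim (hZd _ hu')
    have hSp : MDiffAt (T% (mpullback I' I Φ S)) u := hpull hSd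
    have hTp : MDiffAt (T% (fun u' ↦ gN.leviCivita (mpullback I' I Φ Z) u'
        (mpullback I' I Φ W u'))) u := by
      refine hSp.congr_of_eventuallyEq ?_
      filter_upwards [hloc] with u' hu'
      simp only [hu']
    rw [gN.leviCivita.isCovariantDerivativeOn.congr_of_eventuallyEq hTp hSp Filter.univ_mem hloc,
      g.leviCivita_comap_mpullback_mpullback_cn hpb hΦ hΦ' hdim hSd, mpullback_apply]
  -- the bracket term
  have hbr : gN.leviCivita (mpullback I' I Φ Z) u
      (mlieBracket I' (mpullback I' I Φ X) (mpullback I' I Φ Y) u) =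
      (mfderiv I' I Φ u).inverse (g.leviCivita Z (Φ u) (mlieBracket I X Y (Φ u))) := by
    rw [g.leviCivita_comap_mpullback_apply_cn hpb hΦ hΦ' hdim (hZd _ huO),
      ← mpullback_mlieBracket (hXd _ huO) (hYd _ huO) (hΦ u) hmin,
      mfderiv_mpullback_apply hΦ' hdim]
  simp only [CovariantDerivative.curvatureAux]
  rw [key hX hY, key hY hX, hbr, map_sub, map_sub]

include hΦ' in
/-- **Naturality of the Riemann curvature tensor under local diffeomorphisms, `C^n` metric,
`n ≥ 2`** (O'Neill 1983, Ch. 3, Prop. 3.59): for a `C^{n+1}` equidimensional immersion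
`Φ : N → M`, `R^{Φ^*g}_u (X₀, Y₀) Z₀ = (dΦ_u)⁻¹ (R^g_{Φ u}(dΦ_u X₀, dΦ_u Y₀) dΦ_u Z₀)`.
[cite: ONeill1983, Ch. 3, Prop. 3.59] -/
theorem riemann_comap_apply_cn [g.HasLeviCivita] [(g.comap hpb Φ hΦ hΦ' hdim).HasLeviCivita]
    (hn : 2 ≤ n) (u : N) (X₀ Y₀ Z₀ : TangentSpace I' u) :
    (g.comap hpb Φ hΦ hΦ' hdim).riemann u X₀ Y₀ Z₀ =
      (mfderiv I' I Φ u).inverse (g.riemann (Φ u) (mfderiv I' I Φ u X₀) (mfderiv I' I Φ u Y₀)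
        (mfderiv I' I Φ u Z₀)) := by
  set gN := g.comap hpb Φ hΦ hΦ' hdim with hgN
  have hΦs : ContMDiff I' I n Φ := hΦ.of_le le_self_add
  have hinv : ∀ u', (mfderiv I' I Φ u').IsInvertible := fun u' ↦
    isInvertible_mfderiv_of_injective hdim (hΦ' u')
  haveI : IsManifold I' (minSmoothness ℝ 3) N := by
    rw [minSmoothness_of_isRCLikeNormedField]; infer_instance
  haveI : IsManifold I (minSmoothness ℝ 3) M := by
    rw [minSmoothness_of_isRCLikeNormedField]; infer_instance
  have hm2 : minSmoothness ℝ 2 = 2 := minSmoothness_of_isRCLikeNormedField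
  have h12 : ((1 : ℕ∞) : ℕ∞ω) + 1 = 2 := by norm_num
  have hregM : g.leviCivita.IsLocallyContMDiff 1 :=
    g.isLocallyContMDiff_leviCivita_holds 1 (by rw [h12]; exact hn)
  have hregN : gN.leviCivita.IsLocallyContMDiff 1 :=
    gN.isLocallyContMDiff_leviCivita_holds 1 (by rw [h12]; exact hn)
  -- the extensions on `M` and a common open set where they are `C²`
  set X' : Π x : M, TangentSpace I x := FiberBundle.extend E (mfderiv I' I Φ u X₀) with hX'
  set Y' : Π x : M, TangentSpace I x := FiberBundle.extend E (mfderiv I' I Φ u Y₀) with hY'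
  set Z' : Π x : M, TangentSpace I x := FiberBundle.extend E (mfderiv I' I Φ u Z₀) with hZ'
  obtain ⟨uX, huX, hxX, hX2⟩ := CovariantDerivative.exists_isOpen_contMDiffOn_extend (I := I)
    (mfderiv I' I Φ u X₀)
  obtain ⟨uY, huY, hxY, hY2⟩ := CovariantDerivative.exists_isOpen_contMDiffOn_extend (I := I)
    (mfderiv I' I Φ u Y₀)
  obtain ⟨uZ, huZ, hxZ, hZ2⟩ := CovariantDerivative.exists_isOpen_contMDiffOn_extend (I := I)
    (mfderiv I' I Φ u Z₀)
  set O : Set M := uX ∩ uY ∩ uZ with hO_def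
  have hO : IsOpen O := (huX.inter huY).inter huZ
  have huO : Φ u ∈ O := ⟨⟨hxX, hxY⟩, hxZ⟩
  have hX1 : CMDiff[O] 1 (T% X') :=
    (hX2.of_le (by norm_num)).mono (inter_subset_left.trans inter_subset_left)
  have hY1 : CMDiff[O] 1 (T% Y') :=
    (hY2.of_le (by norm_num)).mono (inter_subset_left.trans inter_subset_right)
  have hZO : CMDiff[O] 2 (T% Z') := hZ2.mono inter_subset_right
  -- `curvature_apply` on `M`
  have hM : g.riemann (Φ u) (mfderiv I' I Φ u X₀) (mfderiv I' I Φ u Y₀) (mfderiv I' I Φ u Z₀) =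
      CovariantDerivative.curvatureAux g.leviCivita X' Y' Z' (Φ u) := by
    have h := g.leviCivita.curvature_apply_of_isLocallyContMDiff (x := Φ u) hregM
      (X := X') (Y := Y') (Z := Z') (mdifferentiableAt_extend ..) (mdifferentiableAt_extend ..)
      (by rw [hm2]; exact (hZO _ huO).contMDiffAt (hO.mem_nhds huO))
    rw [hX', hY', hZ', FiberBundle.extend_apply_self, FiberBundle.extend_apply_self,
      FiberBundle.extend_apply_self] at h
    rw [← hX', ← hY', ← hZ'] at h
    exact h
  -- `curvature_apply` on `N`, on the pulled-back fields
  have hpullC : ∀ {A : Π x : M, TangentSpace I x} {k : ℕ∞ω}, k + 1 ≤ n + 1 → CMDiff[O] k (T% A) →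
      ∀ u' ∈ Φ ⁻¹' O, CMDiffAt k (T% (mpullback I' I Φ A)) u' := by
    intro A k hk hA u' hu'
    exact ((hA _ hu').contMDiffAt (hO.mem_nhds hu')).mpullback_vectorField_preimage (hΦ u')
      (hinv u') hk
  have h1n : (1 : ℕ∞ω) + 1 ≤ n + 1 := add_le_add (Fact.out : (1 : ℕ∞ω) ≤ n) le_rfl
  have h2n : (2 : ℕ∞ω) + 1 ≤ n + 1 := add_le_add hn le_rfl
  have hXp : MDiffAt (T% (mpullback I' I Φ X')) u :=
    (hpullC (k := 1) h1n hX1 u huO).mdifferentiableAt one_ne_zero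
  have hYp : MDiffAt (T% (mpullback I' I Φ Y')) u :=
    (hpullC (k := 1) h1n hY1 u huO).mdifferentiableAt one_ne_zero
  have hZp : CMDiffAt (minSmoothness ℝ 2) (T% (mpullback I' I Φ Z')) u := by
    rw [hm2]
    exact hpullC (k := 2) h2n hZO u huO
  have hN : gN.riemann u X₀ Y₀ Z₀ = CovariantDerivative.curvatureAux gN.leviCivita
      (mpullback I' I Φ X') (mpullback I' I Φ Y') (mpullback I' I Φ Z') u := by
    have h := gN.leviCivita.curvature_apply_of_isLocallyContMDiff (x := u) hregN hXp hYp hZp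
    rw [hX', hY', hZ', mpullback_extend_mfderiv_apply hΦ' hdim, mpullback_extend_mfderiv_apply hΦ' hdim,
      mpullback_extend_mfderiv_apply hΦ' hdim] at h
    rw [← hX', ← hY', ← hZ'] at h
    exact h
  rw [hN, hM]
  exact g.curvatureAux_comap_mpullback_cn hpb hΦ hΦ' hdim hn hO huO hX1 hY1 hZO

include hΦ' in
/-- **Naturality of the Ricci tensor under local diffeomorphisms, `C^n` metric, `n ≥ 2`**:
`Ric^{Φ^*g}_u (Y₀, Z₀) = Ric^g_{Φ u} (dΦ_u Y₀, dΦ_u Z₀)` (conjugate endomorphisms have the same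
trace). O'Neill 1983, Ch. 3, Prop. 3.59 with Lemma 3.52. [cite: ONeill1983, Ch. 3, Prop. 3.59] -/
theorem ricci_comap_apply_cn [g.HasLeviCivita] [(g.comap hpb Φ hΦ hΦ' hdim).HasLeviCivita]
    (hn : 2 ≤ n) (u : N) (Y₀ Z₀ : TangentSpace I' u) :
    (g.comap hpb Φ hΦ hΦ' hdim).ricci u Y₀ Z₀ =
      g.ricci (Φ u) (mfderiv I' I Φ u Y₀) (mfderiv I' I Φ u Z₀) := by
  set e := mfderivEquivOfInjective (I := I) (I' := I') Φ u (hΦ' u) hdim with he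
  rw [ricci_apply, ricci_apply, CovariantDerivative.ricci_apply, CovariantDerivative.ricci_apply]
  have hconj : (g.comap hpb Φ hΦ hΦ' hdim).leviCivita.ricciAux u Y₀ Z₀ =
      e.symm.conj (g.leviCivita.ricciAux (Φ u) (mfderiv I' I Φ u Y₀) (mfderiv I' I Φ u Z₀)) := by
    ext v
    rw [CovariantDerivative.ricciAux_apply, LinearEquiv.conj_apply, LinearMap.comp_apply,
      LinearMap.comp_apply, LinearEquiv.coe_coe, LinearEquiv.coe_coe, LinearEquiv.symm_symm,
      CovariantDerivative.ricciAux_apply]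
    change (g.comap hpb Φ hΦ hΦ' hdim).riemann u v Y₀ Z₀ =
      e.symm (g.riemann (Φ u) (e v) (mfderiv I' I Φ u Y₀) (mfderiv I' I Φ u Z₀))
    rw [g.riemann_comap_apply_cn hpb hΦ hΦ' hdim hn u v Y₀ Z₀, inverse_mfderiv_apply hdim (hΦ' u)]
    rfl
  rw [hconj, LinearMap.trace_conj']

include hΦ' in
/-- **Naturality of the scalar curvature under local diffeomorphisms, `C^n` metric, `n ≥ 2`**:
`S^{Φ^*g}(u) = S^g(Φ u)` (O'Neill 1983, Ch. 3, Prop. 3.59 and Def. 3.53).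
[cite: ONeill1983, Ch. 3, Prop. 3.59] -/
theorem scalarCurvature_comap_cn [g.HasLeviCivita] [(g.comap hpb Φ hΦ hΦ' hdim).HasLeviCivita]
    (hn : 2 ≤ n) (u : N) :
    (g.comap hpb Φ hΦ hΦ' hdim).scalarCurvature u = g.scalarCurvature (Φ u) := by
  haveI : FiniteDimensional ℝ (TangentSpace I' u) := inferInstanceAs (FiniteDimensional ℝ E')
  set e := mfderivEquivOfInjective (I := I) (I' := I') Φ u (hΦ' u) hdim with he
  set β := Module.finBasis ℝ (TangentSpace I' u) with hβ
  set β' : Module.Basis (Fin (Module.finrank ℝ (TangentSpace I' u))) ℝ (TangentSpace I (Φ u)) :=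
    β.map e with hβ'
  rw [scalarCurvature, scalarCurvature,
    trace_eq_sum_gram_inv (g.comap hpb Φ hΦ hΦ' hdim) u β, trace_eq_sum_gram_inv g (Φ u) β']
  have hgram : (Matrix.of fun i j ↦ (g.comap hpb Φ hΦ hΦ' hdim).val u (β i) (β j)) =
      Matrix.of fun i j ↦ g.val (Φ u) (β' i) (β' j) := by
    ext i j
    simp only [Matrix.of_apply, hβ', Module.Basis.map_apply, val_comap, pullbackBilin_apply]
    rfl
  have hric : ∀ i j, (g.comap hpb Φ hΦ hΦ' hdim).ricci u (β i) (β j) =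
      g.ricci (Φ u) (β' i) (β' j) := fun i j ↦ by
    rw [g.ricci_comap_apply_cn hpb hΦ hΦ' hdim hn u (β i) (β j), hβ', Module.Basis.map_apply,
      Module.Basis.map_apply]
    rfl
  rw [hgram]
  simp only [hric]

end Cn

/-! ### The `C^∞` statements (specialisations `n = ∞`) -/

section Smooth

variable {E : Type*} [NormedAddCommGroup E] [NormedSpace ℝ E] {H : Type*} [TopologicalSpace H]
  {I : ModelWithCorners ℝ E H} {M : Type*} [TopologicalSpace M] [ChartedSpace H M]
  [IsManifold I ∞ M]
  {E' : Type*} [NormedAddCommGroup E'] [NormedSpace ℝ E'] {H' : Type*} [TopologicalSpace H']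
  {I' : ModelWithCorners ℝ E' H'} {N : Type*} [TopologicalSpace N] [ChartedSpace H' N]
  [IsManifold I' ∞ N]
  [FiniteDimensional ℝ E] [FiniteDimensional ℝ E'] [CompleteSpace E] [CompleteSpace E']
  (g : PseudoRiemannianMetric I ∞ E (TangentSpace I : M → Type _))
  {Φ : N → M} (hpb : contMDiff_pullbackBilin I M I' N ∞) (hΦ : ContMDiff I' I (∞ + 1) Φ)
  (hΦ' : ∀ u, Function.Injective (mfderiv I' I Φ u))
  (hdim : Module.finrank ℝ E' = Module.finrank ℝ E)

/-! ### The curvature operation on pulled-back fields -/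

include hΦ' in
/-- **Naturality of the bare curvature operation.** For vector fields `X, Y` of class `C¹` and
`Z` of class `C²` on an open set `O ∋ Φ u` of `M`,
`(∇∇Z - ∇∇Z - ∇_{[·,·]}Z)^{Φ^*g}(Φ^*X, Φ^*Y, Φ^*Z)(u) = (dΦ_u)⁻¹ (same for g)(X, Y, Z)(Φ u)`:
each inner covariant derivative of a pulled-back field is the pullback of the covariant
derivative (`leviCivita_comap_mpullback_mpullback`, near `u`), covariant derivatives are local on
differentiable sections, and the bracket of pullbacks is the pullback of the bracket.
O'Neill 1983, Ch. 3, proof of Prop. 3.59. [cite: ONeill1983, Ch. 3, Prop. 3.59] -/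
theorem curvatureAux_comap_mpullback [g.HasLeviCivita] [(g.comap hpb Φ hΦ hΦ' hdim).HasLeviCivita]
    {u : N} {O : Set M} (hO : IsOpen O) (huO : Φ u ∈ O) {X Y Z : Π x : M, TangentSpace I x}
    (hX : CMDiff[O] 1 (T% X)) (hY : CMDiff[O] 1 (T% Y)) (hZ : CMDiff[O] 2 (T% Z)) :
    CovariantDerivative.curvatureAux (g.comap hpb Φ hΦ hΦ' hdim).leviCivita (mpullback I' I Φ X)
        (mpullback I' I Φ Y) (mpullback I' I Φ Z) u =
      (mfderiv I' I Φ u).inverse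
        (CovariantDerivative.curvatureAux g.leviCivita X Y Z (Φ u)) :=
  curvatureAux_comap_mpullback_cn g hpb hΦ hΦ' hdim (WithTop.coe_le_coe.mpr le_top) hO huO hX hY hZ

/-! ### The Riemann tensor -/

include hΦ' in
/-- **Naturality of the Riemann curvature tensor under local diffeomorphisms** (O'Neill 1983,
Ch. 3, Prop. 3.59; Lee 2018, naturality of `Rm`): for a smooth equidimensional immersion
`Φ : N → M` and a smooth metric `g` on `M`,
`R^{Φ^*g}_u (X₀, Y₀) Z₀ = (dΦ_u)⁻¹ (R^g_{Φ u}(dΦ_u X₀, dΦ_u Y₀) dΦ_u Z₀)`.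
Both sides are computed by `curvature_apply` on the canonical extensions of
`dΦ X₀, dΦ Y₀, dΦ Z₀` (which are `C²` near `Φ u`) and on their pullbacks (which are `C²` near `u`
and take the values `X₀, Y₀, Z₀` at `u`), and compared by `curvatureAux_comap_mpullback`.
[cite: ONeill1983, Ch. 3, Prop. 3.59] -/
theorem riemann_comap_apply [g.HasLeviCivita] [(g.comap hpb Φ hΦ hΦ' hdim).HasLeviCivita]
    (u : N) (X₀ Y₀ Z₀ : TangentSpace I' u) :
    (g.comap hpb Φ hΦ hΦ' hdim).riemann u X₀ Y₀ Z₀ =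
      (mfderiv I' I Φ u).inverse (g.riemann (Φ u) (mfderiv I' I Φ u X₀) (mfderiv I' I Φ u Y₀)
        (mfderiv I' I Φ u Z₀)) :=
  riemann_comap_apply_cn g hpb hΦ hΦ' hdim (WithTop.coe_le_coe.mpr le_top) u X₀ Y₀ Z₀

/-! ### The Ricci tensor and the scalar curvature -/

include hΦ' in
/-- **Naturality of the Ricci tensor under local diffeomorphisms**:
`Ric^{Φ^*g}_u (Y₀, Z₀) = Ric^g_{Φ u} (dΦ_u Y₀, dΦ_u Z₀)` — the endomorphism
`v ↦ R^{Φ^*g}(v, Y₀) Z₀` is conjugate by `dΦ_u` to `w ↦ R^g(w, dΦ Y₀) dΦ Z₀`, and conjugate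
endomorphisms have the same trace. O'Neill 1983, Ch. 3, Prop. 3.59 with Lemma 3.52.
[cite: ONeill1983, Ch. 3, Prop. 3.59] -/
theorem ricci_comap_apply [g.HasLeviCivita] [(g.comap hpb Φ hΦ hΦ' hdim).HasLeviCivita]
    (u : N) (Y₀ Z₀ : TangentSpace I' u) :
    (g.comap hpb Φ hΦ hΦ' hdim).ricci u Y₀ Z₀ =
      g.ricci (Φ u) (mfderiv I' I Φ u Y₀) (mfderiv I' I Φ u Z₀) :=
  ricci_comap_apply_cn g hpb hΦ hΦ' hdim (WithTop.coe_le_coe.mpr le_top) u Y₀ Z₀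

include hΦ' in
/-- **Naturality of the scalar curvature under local diffeomorphisms**: `S^{Φ^*g}(u) = S^g(Φ u)`
(O'Neill 1983, Ch. 3, Prop. 3.59 and Def. 3.53). Both metric traces are expanded in bases
(`trace_eq_sum_gram_inv`): a basis `β` of `T_u N` and its image `dΦ_u β` of `T_{Φ u} M` have the
same Gram matrices (`Φ^*g` versus `g`) and the same Ricci components (`ricci_comap_apply`).
[cite: ONeill1983, Ch. 3, Prop. 3.59] -/
theorem scalarCurvature_comap [g.HasLeviCivita] [(g.comap hpb Φ hΦ hΦ' hdim).HasLeviCivita]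
    (u : N) : (g.comap hpb Φ hΦ hΦ' hdim).scalarCurvature u = g.scalarCurvature (Φ u) :=
  scalarCurvature_comap_cn g hpb hΦ hΦ' hdim (WithTop.coe_le_coe.mpr le_top) u

end Smooth

end PseudoRiemannianMetric

end Literature.Geometry.Lorentzian

end
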